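import Mathlib
import Summits.Ventures.PercRepro2.Defs
import Summits.Ventures.PercRepro2.Graph
import Summits.Ventures.PercRepro2.Harris
import Summits.Ventures.PercRepro2.Events
import Summits.Ventures.PercRepro2.Independence
import Summits.Ventures.PercRepro2.Induced
import Summits.Ventures.PercRepro2.Exploration
import Summits.Ventures.PercRepro2.SideCluster
import Summits.Ventures.PercRepro2.CactusDefs

import Summits.Ventures.PercRepro2.CactusTriangle
/-!
# The cluster law along a pendant triangle: the factorisation (blind cell PercRepro2, mine-c g10;
proofs/MINEC-FEEDBACK.md §13)

The trace events of the triangle (`traceEvent`), their probabilities (`prob_traceEvent` = the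
trace law `fTri` of `CactusTriangle`), and the factorisation of the cluster law along a pendant
triangle, `massOn (F ∪ △) W = massOn F ((W.erase y).erase z) · gTri W` (`massOn_insert_triangle`).
-/



namespace Summit.Ventures.PercRepro2

namespace Cactus

open scoped Classical

attribute [local instance 2000] Classical.propDecidable

variable {V : Type*} {E : Type*} [Fintype E] [Fintype V]
variable {R : Type*} [Field R] [LinearOrder R] [IsStrictOrderedRing R]

section Triangle

variable {ends : E → Sym2 V} {F : Set E} {e₁ e₂ e₃ : E} {x y z s : V}

/-! ## The trace events and the factorisation -/

omit [Fintype E] [Fintype V] in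
/-- The trace event of the triangle for the bits `(y ∈ W, z ∈ W) = (b, c)`: `y` is reached from `x`
iff `e₁` is open or `e₂, e₃` are open; `z` symmetrically. -/
def traceEvent (e₁ e₂ e₃ : E) (b c : Bool) : Set (Config E) :=
  {ω | ((ω e₁ = true ∨ (ω e₂ = true ∧ ω e₃ = true)) ↔ b = true) ∧
    ((ω e₂ = true ∨ (ω e₁ = true ∧ ω e₃ = true)) ↔ c = true)}

omit [Fintype E] [Fintype V] in
/-- The trace event depends only on the three edges of the triangle. -/
lemma dependsOn_traceEvent (e₁ e₂ e₃ : E) (b c : Bool) :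
    DependsOn (· ∈ traceEvent e₁ e₂ e₃ b c) ({e₁, e₂, e₃} : Set E) := by
  intro ω ω' h
  have h1 : ω e₁ = ω' e₁ := h e₁ (by simp)
  have h2 : ω e₂ = ω' e₂ := h e₂ (by simp)
  have h3 : ω e₃ = ω' e₃ := h e₃ (by simp)
  simp only [traceEvent, Set.mem_setOf_eq, h1, h2, h3]

omit [Fintype V] [LinearOrder R] [IsStrictOrderedRing R] in
/-- `P(e₁ open, e₂ closed, e₃ closed) = p₁ (1 − p₂)(1 − p₃)` and its relatives. -/
lemma prob_three (p : E → R) {e₁ e₂ e₃ : E} (h₁₂ : e₁ ≠ e₂) (h₁₃ : e₁ ≠ e₃) (h₂₃ : e₂ ≠ e₃)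
    (A : Set (Config E)) (B : Set (Config E)) (C : Set (Config E))
    (hA : DependsOn (· ∈ A) ({e₁} : Set E)) (hB : DependsOn (· ∈ B) ({e₂} : Set E))
    (hC : DependsOn (· ∈ C) ({e₃} : Set E)) :
    prob p (A ∩ B ∩ C) = prob p A * prob p B * prob p C := by
  rw [prob_inter_eq_mul_of_dependsOn p (F₁ := {e₁} ∪ {e₂}) (F₂ := {e₃}) ?_ (dependsOn_inter hA hB) hC,
    prob_inter_eq_mul_of_dependsOn p (F₁ := {e₁}) (F₂ := {e₂}) (Set.disjoint_singleton.2 h₁₂) hA hB]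
  rw [Set.disjoint_union_left]
  exact ⟨Set.disjoint_singleton.2 h₁₃, Set.disjoint_singleton.2 h₂₃⟩

omit [Fintype V] [LinearOrder R] [IsStrictOrderedRing R] in
/-- **The probability of the trace event is the trace law.** -/
lemma prob_traceEvent (p : E → R) {e₁ e₂ e₃ : E} (h₁₂ : e₁ ≠ e₂) (h₁₃ : e₁ ≠ e₃) (h₂₃ : e₂ ≠ e₃)
    (b c : Bool) : prob p (traceEvent e₁ e₂ e₃ b c) = fTri (p e₁) (p e₂) (p e₃) b c := by
  -- the four trace events as products of edge statuses
  have hTy : traceEvent e₁ e₂ e₃ true false = openEdge e₁ ∩ closedEdge e₂ ∩ closedEdge e₃ := by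
    ext ω
    simp only [traceEvent, Set.mem_setOf_eq, Set.mem_inter_iff, openEdge, closedEdge]
    rcases Bool.eq_false_or_eq_true (ω e₁) with h1 | h1 <;>
      rcases Bool.eq_false_or_eq_true (ω e₂) with h2 | h2 <;>
      rcases Bool.eq_false_or_eq_true (ω e₃) with h3 | h3 <;> simp [h1, h2, h3]
  have hTz : traceEvent e₁ e₂ e₃ false true = closedEdge e₁ ∩ openEdge e₂ ∩ closedEdge e₃ := by
    ext ω
    simp only [traceEvent, Set.mem_setOf_eq, Set.mem_inter_iff, openEdge, closedEdge]
    rcases Bool.eq_false_or_eq_true (ω e₁) with h1 | h1 <;>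
      rcases Bool.eq_false_or_eq_true (ω e₂) with h2 | h2 <;>
      rcases Bool.eq_false_or_eq_true (ω e₃) with h3 | h3 <;> simp [h1, h2, h3]
  have hT0 : traceEvent e₁ e₂ e₃ false false = closedEdge e₁ ∩ closedEdge e₂ := by
    ext ω
    simp only [traceEvent, Set.mem_setOf_eq, Set.mem_inter_iff, closedEdge]
    rcases Bool.eq_false_or_eq_true (ω e₁) with h1 | h1 <;>
      rcases Bool.eq_false_or_eq_true (ω e₂) with h2 | h2 <;>
      rcases Bool.eq_false_or_eq_true (ω e₃) with h3 | h3 <;> simp [h1, h2, h3]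
  have hTyz : traceEvent e₁ e₂ e₃ true true =
      (traceEvent e₁ e₂ e₃ true false ∪ traceEvent e₁ e₂ e₃ false true ∪
        traceEvent e₁ e₂ e₃ false false)ᶜ := by
    ext ω
    simp only [traceEvent, Set.mem_setOf_eq, Set.mem_compl_iff, Set.mem_union]
    rcases Bool.eq_false_or_eq_true (ω e₁) with h1 | h1 <;>
      rcases Bool.eq_false_or_eq_true (ω e₂) with h2 | h2 <;>
      rcases Bool.eq_false_or_eq_true (ω e₃) with h3 | h3 <;> simp [h1, h2, h3]
  have py : prob p (traceEvent e₁ e₂ e₃ true false) = p e₁ * (1 - p e₂) * (1 - p e₃) := by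
    rw [hTy, prob_three p h₁₂ h₁₃ h₂₃ _ _ _ (dependsOn_openEdge e₁) (dependsOn_closedEdge e₂)
      (dependsOn_closedEdge e₃), prob_openEdge, prob_closedEdge, prob_closedEdge]
  have pz : prob p (traceEvent e₁ e₂ e₃ false true) = (1 - p e₁) * p e₂ * (1 - p e₃) := by
    rw [hTz, prob_three p h₁₂ h₁₃ h₂₃ _ _ _ (dependsOn_closedEdge e₁) (dependsOn_openEdge e₂)
      (dependsOn_closedEdge e₃), prob_openEdge, prob_closedEdge, prob_closedEdge]
  have p0 : prob p (traceEvent e₁ e₂ e₃ false false) = (1 - p e₁) * (1 - p e₂) := by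
    rw [hT0, prob_inter_eq_mul_of_dependsOn p (Set.disjoint_singleton.2 h₁₂)
      (dependsOn_closedEdge e₁) (dependsOn_closedEdge e₂), prob_closedEdge, prob_closedEdge]
  cases b <;> cases c
  · rw [p0]; simp [fTri]
  · rw [pz]; simp [fTri]
  · rw [py]; simp [fTri]
  · rw [hTyz, prob_compl, prob_union_of_disjoint, prob_union_of_disjoint, py, pz, p0]
    · simp only [fTri, if_true]
      ring
    · rw [hTy, hTz]
      rw [Set.disjoint_left]
      rintro ω ⟨⟨h1, _⟩, _⟩ ⟨⟨h1', _⟩, _⟩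
      simp only [openEdge, closedEdge, Set.mem_setOf_eq] at h1 h1'
      rw [h1] at h1'; exact Bool.false_ne_true h1'.symm
    · rw [hTy, hTz, hT0]
      rw [Set.disjoint_left]
      rintro ω (⟨⟨h1, _⟩, _⟩ | ⟨⟨_, h2⟩, _⟩) ⟨h1', h2'⟩
      · simp only [openEdge, closedEdge, Set.mem_setOf_eq] at h1 h1'
        rw [h1] at h1'; exact Bool.false_ne_true h1'.symm
      · simp only [openEdge, closedEdge, Set.mem_setOf_eq] at h2 h2'
        rw [h2] at h2'; exact Bool.false_ne_true h2'.symm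

omit [LinearOrder R] [IsStrictOrderedRing R] [Fintype V] in
/-- **The cluster law along a pendant triangle**:
`massOn (F ∪ △) W = massOn F ((W.erase y).erase z) · gTri W`. -/
theorem massOn_insert_triangle (p : E → R) (h₁ : ends e₁ = s(x, y)) (h₂ : ends e₂ = s(x, z))
    (h₃ : ends e₃ = s(y, z)) (hxy : x ≠ y) (hxz : x ≠ z) (hyz : y ≠ z) (hys : y ≠ s) (hzs : z ≠ s)
    (hy : ∀ e' ∈ F, y ∉ ends e') (hz : ∀ e' ∈ F, z ∉ ends e') (h₁₂ : e₁ ≠ e₂) (h₁₃ : e₁ ≠ e₃)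
    (h₂₃ : e₂ ≠ e₃) (hn₁ : e₁ ∉ F) (hn₂ : e₂ ∉ F) (hn₃ : e₃ ∉ F) (W : Finset V) :
    massOn p ends (insert e₁ (insert e₂ (insert e₃ F))) s W =
      massOn p ends F s ((W.erase y).erase z) * gTri p e₁ e₂ e₃ x y z W := by
  unfold massOn gTri
  have hcl := clusterOn_insert_triangle h₁ h₂ h₃ hxy hxz hyz hys hzs hy hz
  have hyF : ∀ ω, y ∉ clusterOn ends F ω s := fun ω => y_notMem_clusterOn hys hy ω
  have hzF : ∀ ω, z ∉ clusterOn ends F ω s := fun ω => y_notMem_clusterOn hzs hz ω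
  have hdep : DependsOn (· ∈ {ω : Config E | clusterOn ends F ω s = ↑((W.erase y).erase z)}) F :=
    dependsOn_restrict F (fun ω' => cluster ends ω' s = ↑((W.erase y).erase z))
  have hdisj : Disjoint F ({e₁, e₂, e₃} : Set E) := by
    rw [Set.disjoint_right]
    intro e he
    simp only [Set.mem_insert_iff, Set.mem_singleton_iff] at he
    rcases he with rfl | rfl | rfl
    · exact hn₁
    · exact hn₂
    · exact hn₃
  have hmemW'' : ∀ v, v ∈ (W.erase y).erase z ↔ v ∈ W ∧ v ≠ y ∧ v ≠ z := by
    intro v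
    simp only [Finset.mem_erase]
    tauto
  by_cases hx : x ∈ W
  · have hxW'' : x ∈ (W.erase y).erase z := (hmemW'' x).2 ⟨hx, hxy, hxz⟩
    have hset : {ω : Config E | clusterOn ends (insert e₁ (insert e₂ (insert e₃ F))) ω s = ↑W} =
        {ω | clusterOn ends F ω s = ↑((W.erase y).erase z)} ∩
          traceEvent e₁ e₂ e₃ (decide (y ∈ W)) (decide (z ∈ W)) := by
      ext ω
      simp only [Set.mem_setOf_eq, Set.mem_inter_iff, traceEvent, decide_eq_true_eq]
      constructor
      · intro h
        have hxC : x ∈ clusterOn ends F ω s := by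
          have : x ∈ clusterOn ends (insert e₁ (insert e₂ (insert e₃ F))) ω s := by
            rw [h]; exact Finset.mem_coe.2 hx
          rcases (hcl ω x).1 this with h' | ⟨h', _⟩ | ⟨h', _⟩
          · exact h'
          · exact (hxy h').elim
          · exact (hxz h').elim
        refine ⟨?_, ?_, ?_⟩
        · ext v
          rw [Finset.mem_coe, hmemW'' v]
          constructor
          · intro hv
            have : v ∈ clusterOn ends (insert e₁ (insert e₂ (insert e₃ F))) ω s := (hcl ω v).2 (Or.inl hv)
            rw [h] at this
            exact ⟨Finset.mem_coe.1 this, fun hvy => hyF ω (hvy ▸ hv), fun hvz => hzF ω (hvz ▸ hv)⟩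
          · rintro ⟨hv, hvy, hvz⟩
            have : v ∈ clusterOn ends (insert e₁ (insert e₂ (insert e₃ F))) ω s := by
              rw [h]; exact Finset.mem_coe.2 hv
            rcases (hcl ω v).1 this with h' | ⟨h', _⟩ | ⟨h', _⟩
            · exact h'
            · exact (hvy h').elim
            · exact (hvz h').elim
        · have : y ∈ clusterOn ends (insert e₁ (insert e₂ (insert e₃ F))) ω s ↔ y ∈ W := by
            rw [h]; exact Finset.mem_coe
          rw [← this, hcl ω y]
          constructor
          · intro hc; exact Or.inr (Or.inl ⟨rfl, hxC, hc⟩)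
          · rintro (h' | ⟨_, _, hc⟩ | ⟨h', _⟩)
            · exact (hyF ω h').elim
            · exact hc
            · exact (hyz h').elim
        · have : z ∈ clusterOn ends (insert e₁ (insert e₂ (insert e₃ F))) ω s ↔ z ∈ W := by
            rw [h]; exact Finset.mem_coe
          rw [← this, hcl ω z]
          constructor
          · intro hc; exact Or.inr (Or.inr ⟨rfl, hxC, hc⟩)
          · rintro (h' | ⟨h', _⟩ | ⟨_, _, hc⟩)
            · exact (hzF ω h').elim
            · exact (hyz h'.symm).elim
            · exact hc
      · rintro ⟨h, hty, htz⟩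
        have hxC : x ∈ clusterOn ends F ω s := by rw [h]; exact Finset.mem_coe.2 hxW''
        ext v
        rw [hcl ω v, h, Finset.mem_coe, Finset.mem_coe, hmemW'' v]
        constructor
        · rintro (⟨hv, _, _⟩ | ⟨rfl, _, hc⟩ | ⟨rfl, _, hc⟩)
          · exact hv
          · exact hty.1 hc
          · exact htz.1 hc
        · intro hv
          by_cases hvy : v = y
          · exact Or.inr (Or.inl ⟨hvy, hxW'', hty.2 (hvy ▸ hv)⟩)
          by_cases hvz : v = z
          · exact Or.inr (Or.inr ⟨hvz, hxW'', htz.2 (hvz ▸ hv)⟩)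
          exact Or.inl ⟨hv, hvy, hvz⟩
    rw [hset, prob_inter_eq_mul_of_dependsOn p hdisj hdep (dependsOn_traceEvent e₁ e₂ e₃ _ _),
      prob_traceEvent p h₁₂ h₁₃ h₂₃]
    simp only [gTriBool, hx, decide_true, if_true]
  · by_cases hyz' : y ∈ W ∨ z ∈ W
    · -- `y ∈ W` or `z ∈ W` without `x ∈ W` is impossible
      have hg : gTriBool (p e₁) (p e₂) (p e₃) (decide (x ∈ W)) (decide (y ∈ W)) (decide (z ∈ W)) = 0 := by
        simp only [gTriBool, hx, decide_false, Bool.false_eq_true, if_false]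
        rcases hyz' with h | h <;> simp [h]
      rw [hg, mul_zero]
      rw [show {ω : Config E | clusterOn ends (insert e₁ (insert e₂ (insert e₃ F))) ω s = ↑W} = ∅
        from ?_, prob_empty]
      rw [Set.eq_empty_iff_forall_notMem]
      intro ω h
      have h' : clusterOn ends (insert e₁ (insert e₂ (insert e₃ F))) ω s = ↑W := h
      have hxC : x ∈ clusterOn ends F ω s := by
        rcases hyz' with hyW | hzW
        · have : y ∈ clusterOn ends (insert e₁ (insert e₂ (insert e₃ F))) ω s := by
            rw [h']; exact Finset.mem_coe.2 hyW
          rcases (hcl ω y).1 this with h'' | ⟨_, h'', _⟩ | ⟨h'', _⟩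
          · exact (hyF ω h'').elim
          · exact h''
          · exact (hyz h'').elim
        · have : z ∈ clusterOn ends (insert e₁ (insert e₂ (insert e₃ F))) ω s := by
            rw [h']; exact Finset.mem_coe.2 hzW
          rcases (hcl ω z).1 this with h'' | ⟨h'', _⟩ | ⟨_, h'', _⟩
          · exact (hzF ω h'').elim
          · exact (hyz h''.symm).elim
          · exact h''
      have : x ∈ clusterOn ends (insert e₁ (insert e₂ (insert e₃ F))) ω s := (hcl ω x).2 (Or.inl hxC)
      rw [h'] at this
      exact hx (Finset.mem_coe.1 this)
    · simp only [not_or] at hyz'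
      obtain ⟨hyW, hzW⟩ := hyz'
      have hg : gTriBool (p e₁) (p e₂) (p e₃) (decide (x ∈ W)) (decide (y ∈ W)) (decide (z ∈ W)) = 1 := by
        simp [gTriBool, hx, hyW, hzW]
      rw [hg, mul_one, Finset.erase_eq_of_notMem (fun h => hzW (Finset.mem_of_mem_erase h)),
        Finset.erase_eq_of_notMem hyW]
      congr 1
      ext ω
      simp only [Set.mem_setOf_eq]
      constructor
      · intro h
        ext v
        constructor
        · intro hv
          have : v ∈ clusterOn ends (insert e₁ (insert e₂ (insert e₃ F))) ω s := (hcl ω v).2 (Or.inl hv)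
          rw [h] at this; exact this
        · intro hv
          have : v ∈ clusterOn ends (insert e₁ (insert e₂ (insert e₃ F))) ω s := by rw [h]; exact hv
          rcases (hcl ω v).1 this with h' | ⟨rfl, _⟩ | ⟨rfl, _⟩
          · exact h'
          · exact (hyW (Finset.mem_coe.1 hv)).elim
          · exact (hzW (Finset.mem_coe.1 hv)).elim
      · intro h
        ext v
        rw [hcl ω v, h]
        constructor
        · rintro (hv | ⟨_, hxC, _⟩ | ⟨_, hxC, _⟩)
          · exact hv
          · exact (hx (Finset.mem_coe.1 hxC)).elim
          · exact (hx (Finset.mem_coe.1 hxC)).elim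
        · exact fun hv => Or.inl hv

end Triangle

end Cactus

end Summit.Ventures.PercRepro2
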